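import Mathlib

/-!
# Graded bottom-component rank lemma (crux `ValuativeGCT.ValuativeFlip`, stub `stub_fourRowPencilRank`)

Part P3 of the cyclic-tridiagonal architecture for hypothesis `H` of
`fourRowPencilRank_of_pencilCertificate` (`Cruxes/ValuativeFlip/AxisK9G1a2CyclicTridiagonal.md`, §4):
the generators `λ · string · continuant` of the tangent space of the cyclic tridiagonal pencil are NOT
weighted-homogeneous for the Left-degree (degree in `y₀, y₁`), but each has a nonzero LOWEST component
(the all-monomer term of the continuant) sitting in a known degree `b i`.  Independence of those
bottom components, level by level, gives independence of the whole family — a filtered version of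
the class split `prc_linearIndependent_of_classes` (`…PencilRankClassSplit.lean`):

* `gbr_linearIndependent_of_bottom` — abstract: linear maps `π a` with `π a (f i) = 0` for
  `a < b i`; if for every level `a` the family `π a (f i)`, `b i = a`, is linearly independent then
  `f` is (read a relation in the minimal level carrying a nonzero coefficient);
* `gbr_card_le_finrank_span_of_bottom` — the finrank form for a sub-family (shape of `H`);
* `gbr_weightedHomogeneousComponent_mul_eq_zero_of_lt` /
  `gbr_weightedHomogeneousComponent_mul_eq_mul` — the polynomial instance: for `p` weighted-homogeneous
  of weight `d` (weights in `ℕ`), `p * q` has no component below `d` and its degree-`d` component is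
  `p * (component 0 of q)`;
* `gbr_linearIndependent_mul_of_bottom` — the packaged form used by the strata count: products
  `p i * q i` with `p i` homogeneous of weight `b i` are independent as soon as, level by level, the
  bottoms `p i * (q i)₀` are.

[folklore]
-/

set_option linter.dupNamespace false

namespace Summit.ValiantsHypothesis.ValiantsHypothesis.Theorems.ValuativeFlip

open scoped BigOperators

/-- **Bottom components decide independence.**  Let `b : ι → A` assign a level to each member of a
family `f` and let `π a` be linear maps killing `f i` strictly below its level (`π a (f i) = 0` for
`a < b i`).  If for every level `a` the family `π a (f i)`, `i` of level `a`, is linearly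
independent, then `f` is linearly independent: in a finite relation, project onto the least level
carrying a nonzero coefficient. [folklore] -/
theorem gbr_linearIndependent_of_bottom {R V W A ι : Type*} [CommRing R] [AddCommGroup V]
    [Module R V] [AddCommGroup W] [Module R W] [LinearOrder A]
    (π : A → V →ₗ[R] W) (b : ι → A) (f : ι → V)
    (hlow : ∀ i a, a < b i → π a (f i) = 0)
    (h : ∀ a, LinearIndependent R fun i : {i // b i = a} => π a (f i)) :
    LinearIndependent R f := by
  classical
  rw [linearIndependent_iff']
  intro s g hg
  by_contra hcon
  obtain ⟨i₀, hi₀⟩ := not_forall.mp hcon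
  obtain ⟨hi₀s, hgi₀⟩ := Classical.not_imp.mp hi₀
  set T := s.filter (fun i => g i ≠ 0) with hT
  have hi₀T : i₀ ∈ T := Finset.mem_filter.mpr ⟨hi₀s, hgi₀⟩
  have hTne : (T.image b).Nonempty := ⟨b i₀, Finset.mem_image_of_mem b hi₀T⟩
  set a₀ := (T.image b).min' hTne with ha₀
  obtain ⟨i₁, hi₁T, hbi₁⟩ : ∃ i₁ ∈ T, b i₁ = a₀ := by
    have hmem := Finset.min'_mem (T.image b) hTne
    rw [← ha₀, Finset.mem_image] at hmem
    exact hmem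
  have hmin : ∀ i ∈ T, a₀ ≤ b i := fun i hi => Finset.min'_le _ _ (Finset.mem_image_of_mem b hi)
  -- project the relation onto level `a₀`
  have hproj := congrArg (π a₀) hg
  rw [map_sum, map_zero] at hproj
  have hterm : ∀ i ∈ s, π a₀ (g i • f i) = if b i = a₀ then g i • π a₀ (f i) else 0 := by
    intro i hi
    rw [map_smul]
    split_ifs with hb
    · rfl
    · rcases lt_or_gt_of_ne hb with hlt | hgt
      · have hgi : g i = 0 := by
          by_contra hne
          exact absurd (hmin i (Finset.mem_filter.mpr ⟨hi, hne⟩)) (not_le.mpr hlt)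
        rw [hgi, zero_smul]
      · rw [hlow i a₀ hgt, smul_zero]
  have hsum : ∑ i ∈ s.filter (fun i => b i = a₀), g i • π a₀ (f i) = 0 := by
    rw [Finset.sum_filter, ← Finset.sum_congr rfl hterm]
    exact hproj
  -- independence at level `a₀`
  have hli := (linearIndependent_iff'.mp (h a₀))
    ((s.filter fun i => b i = a₀).subtype fun i => b i = a₀) (fun i => g i) ?_ ⟨i₁, hbi₁⟩ ?_
  · exact (Finset.mem_filter.mp hi₁T).2 hli
  · have hmap : ((s.filter fun i => b i = a₀).subtype fun i => b i = a₀).map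
        (Function.Embedding.subtype fun i => b i = a₀) = s.filter fun i => b i = a₀ := by
      ext x
      simp only [Finset.mem_map, Finset.mem_subtype, Function.Embedding.subtype_apply,
        Finset.mem_filter]
      constructor
      · rintro ⟨y, hy, rfl⟩
        exact hy
      · intro hx
        exact ⟨⟨x, hx.2⟩, hx, rfl⟩
    have hs := Finset.sum_map ((s.filter fun i => b i = a₀).subtype fun i => b i = a₀)
      (Function.Embedding.subtype fun i => b i = a₀) (fun i => g i • π a₀ (f i))
    rw [hmap] at hs
    simp only [Function.Embedding.subtype_apply] at hs
    rw [← hs]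
    exact hsum
  · rw [Finset.mem_subtype]
    exact Finset.mem_filter.mpr ⟨(Finset.mem_filter.mp hi₁T).1, hbi₁⟩

/-- **Bottom components decide independence, finrank form** (shape of hypothesis `H`): for a finite
family `v` and a sub-family `v ∘ e` with levels `b`, projections `π a` killing `v (e k)` below level
`b k`, and level-wise independent bottoms, `card κ ≤ finrank (span (range v))`. [folklore] -/
theorem gbr_card_le_finrank_span_of_bottom {K V W A ι κ : Type*} [Field K] [AddCommGroup V]
    [Module K V] [AddCommGroup W] [Module K W] [LinearOrder A] [Fintype ι] [Fintype κ]
    (π : A → V →ₗ[K] W) (v : ι → V) (e : κ → ι) (b : κ → A)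
    (hlow : ∀ k a, a < b k → π a (v (e k)) = 0)
    (h : ∀ a, LinearIndependent K fun k : {k // b k = a} => π a (v (e k))) :
    Fintype.card κ ≤ Module.finrank K ↥(Submodule.span K (Set.range v)) := by
  have hli : LinearIndependent K (v ∘ e) := gbr_linearIndependent_of_bottom π b (v ∘ e) hlow h
  have h1 : Fintype.card κ ≤ Module.finrank K ↥(Submodule.span K (Set.range (v ∘ e))) :=
    linearIndependent_iff_card_le_finrank_span.mp hli
  haveI : Module.Finite K ↥(Submodule.span K (Set.range v)) :=
    Module.Finite.span_of_finite K (Set.finite_range v)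
  exact h1.trans (Submodule.finrank_mono (Submodule.span_mono (Set.range_comp_subset_range e v)))

/-- A product `p * q` with `p` weighted-homogeneous of weight `d` (weights in `ℕ`) has no weighted
homogeneous component of weight `a < d`. [folklore] -/
theorem gbr_weightedHomogeneousComponent_mul_eq_zero_of_lt {σ R : Type*} [CommRing R]
    (w : σ → ℕ) {p q : MvPolynomial σ R} {d a : ℕ}
    (hp : MvPolynomial.IsWeightedHomogeneous w p d) (ha : a < d) :
    MvPolynomial.weightedHomogeneousComponent w a (p * q) = 0 := by
  classical
  apply MvPolynomial.weightedHomogeneousComponent_eq_zero'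
  intro m hm
  obtain ⟨m₁, hm₁, m₂, _, rfl⟩ := Finset.mem_add.mp (MvPolynomial.support_mul p q hm)
  have h1 : Finsupp.weight w m₁ = d := hp (MvPolynomial.mem_support_iff.mp hm₁)
  rw [map_add, h1]
  omega

/-- For `p` weighted-homogeneous of weight `d` (weights in `ℕ`), the weight-`d` component of `p * q`
is `p` times the weight-`0` component of `q` (the "bottom" of the product). [folklore] -/
theorem gbr_weightedHomogeneousComponent_mul_eq_mul {σ R : Type*} [CommRing R]
    (w : σ → ℕ) {p q : MvPolynomial σ R} {d : ℕ}
    (hp : MvPolynomial.IsWeightedHomogeneous w p d) :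
    MvPolynomial.weightedHomogeneousComponent w d (p * q) =
      p * MvPolynomial.weightedHomogeneousComponent w 0 q := by
  classical
  ext m
  rw [MvPolynomial.coeff_weightedHomogeneousComponent, MvPolynomial.coeff_mul,
    MvPolynomial.coeff_mul]
  by_cases hm : Finsupp.weight w m = d
  · rw [if_pos hm]
    refine Finset.sum_congr rfl fun x hx => ?_
    rw [MvPolynomial.coeff_weightedHomogeneousComponent]
    by_cases hx1 : MvPolynomial.coeff x.1 p = 0
    · rw [hx1, zero_mul, zero_mul]
    · have hw1 : Finsupp.weight w x.1 = d := hp hx1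
      have hsum : x.1 + x.2 = m := Finset.HasAntidiagonal.mem_antidiagonal.mp hx
      have hw2 : Finsupp.weight w x.2 = 0 := by
        have := congrArg (Finsupp.weight w) hsum
        rw [map_add, hw1, hm] at this
        omega
      rw [if_pos hw2]
  · rw [if_neg hm]
    symm
    refine Finset.sum_eq_zero fun x hx => ?_
    rw [MvPolynomial.coeff_weightedHomogeneousComponent]
    by_cases hx1 : MvPolynomial.coeff x.1 p = 0
    · rw [hx1, zero_mul]
    · have hw1 : Finsupp.weight w x.1 = d := hp hx1
      have hsum : x.1 + x.2 = m := Finset.HasAntidiagonal.mem_antidiagonal.mp hx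
      rw [if_neg, mul_zero]
      intro hw2
      apply hm
      have := congrArg (Finsupp.weight w) hsum
      rw [map_add, hw1, hw2, add_zero] at this
      exact this.symm

/-- **Packaged form for products.**  A finite family of products `p i * q i` of polynomials, with
`p i` weighted-homogeneous of weight `b i` (weights in `ℕ`), is linearly independent as soon as for
every level `a` the bottoms `p i * (weight-0 component of q i)`, `b i = a`, are. [folklore] -/
theorem gbr_linearIndependent_mul_of_bottom {σ R ι : Type*} [CommRing R] (w : σ → ℕ)
    (p q : ι → MvPolynomial σ R) (b : ι → ℕ)
    (hp : ∀ i, MvPolynomial.IsWeightedHomogeneous w (p i) (b i))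
    (h : ∀ a, LinearIndependent R fun i : {i // b i = a} =>
      p i * MvPolynomial.weightedHomogeneousComponent w 0 (q i)) :
    LinearIndependent R fun i => p i * q i := by
  refine gbr_linearIndependent_of_bottom
    (fun a => MvPolynomial.weightedHomogeneousComponent w a) b (fun i => p i * q i)
    (fun i a ha => gbr_weightedHomogeneousComponent_mul_eq_zero_of_lt w (hp i) ha) ?_
  intro a
  have heq : (fun i : {i // b i = a} => MvPolynomial.weightedHomogeneousComponent w a (p i * q i)) =
      fun i : {i // b i = a} => p i * MvPolynomial.weightedHomogeneousComponent w 0 (q i) := by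
    funext i
    have key := gbr_weightedHomogeneousComponent_mul_eq_mul w (q := q i) (hp i)
    rw [i.2] at key
    exact key
  rw [heq]
  exact h a

end Summit.ValiantsHypothesis.ValiantsHypothesis.Theorems.ValuativeFlip
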